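import Mathlib
import Literature.AlgebraicGeometry.Tropical.TorusCycles
import HarnessLib

/-!
# Crux `TropicalWeilVanishing` (stmt-HodgeConjecture-18478), line `identity_transfer` — the linear
# realisation system of a combinatorial type and the DICHOTOMY at a seed

Route `TropicalWeilObstruction` of `HodgeConjecture`. For an effective tropical `n`-cycle `Z₀` on
`ℝ²ⁿ/Q₀ℤ²ⁿ` (certificate format `TropicalTorusCycle (2n) n Q₀`, Mikhalkin–Zharkov Def. 4.2), freezing
its discrete data turns "the type of `Z₀` realises over the period `P`" into a LINEAR system
`Φ u = Ψ(P)` in the real data `u` (vertices, edge matrices, reference facets), with integer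
coefficients (`realisationSystem`). Hence the dichotomy `obstructed_or_linearSection`: EITHER
`Ψ(Sym_J) ⊄ range Φ` — then a linear functional vanishing on `range Φ` is non-zero on some symmetric
`J`-commuting matrix and kills every symmetric `J`-commuting period over which the type realises
(OBSTRUCTED AT `Q₀`) — OR `Ψ(Sym_J) ⊆ range Φ`, i.e. the linearised system is solvable in every
direction of `Sym_J`, and then (`linearSpread`) an affine family of real data through the data of `Z₀`
realises the type over every symmetric `J`-commuting `P` (consumer: `…IdentityCriterion`).

Mathlib only; no definition, no named fact, no sorry.

## References

* [Zharkov2020TropicalWeil] I. Zharkov, Tropical abelian varieties, Weil classes and the Hodge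
  conjecture, arXiv:2002.02347 (2020), §1–2 (pp. 2–4).
* [MikhalkinZharkov2014Eigenwave] G. Mikhalkin, I. Zharkov, Tropical eigenwave and intermediate
  Jacobians, LN UMI 15 (2014), Def. 4.2, Prop. 4.3.
-/

-- `Summit.HodgeConjecture.HodgeConjecture.…` is the mandated namespace (single-conjunct summit).
set_option linter.dupNamespace false

noncomputable section

open scoped BigOperators Matrix Topology
open Matrix Literature.AlgebraicGeometry.Tropical

namespace Summit.HodgeConjecture.HodgeConjecture.Theorems.TropicalWeilVanishing

/-! ### The linear realisation system of a combinatorial type -/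

/-- **The realisation system.** For an effective tropical `n`-cycle `Z₀` over any period `Q₀` there
are real-linear maps `Φ` (on the data space: vertices ⊕ reference facets ⊕ edge matrices) and `Ψ` (on
matrix entries) such that `Φ u = Ψ t` says exactly that the data `u` satisfy the edge equations and the
facet identifications of the combinatorial type of `Z₀` over the period with entries `t`; the data of
`Z₀` solve it at `Q₀`. [cite: MikhalkinZharkov2014Eigenwave, Def. 4.2] -/
theorem realisationSystem {n : ℕ} {Q₀ : Matrix (Fin (2 * n)) (Fin (2 * n)) ℝ}
    (Z₀ : TropicalTorusCycle (2 * n) n Q₀) :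
    ∃ (Φ : ((Fin Z₀.numCells × Fin (n + 1) × Fin (2 * n)) ⊕
          ((Fin Z₀.numFacetClasses × Fin n × Fin (2 * n)) ⊕ (Fin Z₀.numCells × Fin n × Fin n)) → ℝ) →ₗ[ℝ]
        ((Fin Z₀.numCells × Fin n × Fin (2 * n)) ⊕ (Fin Z₀.numCells × Fin (n + 1) × Fin n × Fin (2 * n)) → ℝ))
      (Ψ : (Fin (2 * n) × Fin (2 * n) → ℝ) →ₗ[ℝ]
        ((Fin Z₀.numCells × Fin n × Fin (2 * n)) ⊕ (Fin Z₀.numCells × Fin (n + 1) × Fin n × Fin (2 * n)) → ℝ))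
      (u₀ : (Fin Z₀.numCells × Fin (n + 1) × Fin (2 * n)) ⊕
          ((Fin Z₀.numFacetClasses × Fin n × Fin (2 * n)) ⊕ (Fin Z₀.numCells × Fin n × Fin n)) → ℝ),
      (∀ u t, Φ u = Ψ t ↔
        ((∀ (σ : Fin Z₀.numCells) (j : Fin n) (a : Fin (2 * n)),
            u (Sum.inl (σ, j.succ, a)) - u (Sum.inl (σ, 0, a)) =
              ∑ m, ((Z₀.cell σ).frame a m : ℝ) * u (Sum.inr (Sum.inr (σ, m, j)))) ∧
         (∀ (σ : Fin Z₀.numCells) (i : Fin (n + 1)) (j : Fin n) (a : Fin (2 * n)),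
            u (Sum.inl (σ, i.succAbove (Z₀.facetPerm σ i j), a)) =
              u (Sum.inr (Sum.inl (Z₀.facetClass σ i, j, a))) +
                ∑ b, t (a, b) * (Z₀.facetShift σ i b : ℝ)))) ∧
      (∀ σ j a, u₀ (Sum.inl (σ, j, a)) = (Z₀.cell σ).vertex j a) ∧
      (∀ σ m j, u₀ (Sum.inr (Sum.inr (σ, m, j))) = (Z₀.cell σ).edgeCoeff m j) ∧
      Φ u₀ = Ψ (fun ab => Q₀ ab.1 ab.2) := by
  classical
  let κ : Type := (Fin Z₀.numCells × Fin (n + 1) × Fin (2 * n)) ⊕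
    ((Fin Z₀.numFacetClasses × Fin n × Fin (2 * n)) ⊕ (Fin Z₀.numCells × Fin n × Fin n))
  let μ : Type := (Fin Z₀.numCells × Fin n × Fin (2 * n)) ⊕
    (Fin Z₀.numCells × Fin (n + 1) × Fin n × Fin (2 * n))
  let ι : Type := Fin (2 * n) × Fin (2 * n)
  let pκ : κ → (κ → ℝ) →ₗ[ℝ] ℝ := fun k => LinearMap.proj (R := ℝ) (φ := fun _ : κ => ℝ) k
  let pι : ι → (ι → ℝ) →ₗ[ℝ] ℝ := fun i => LinearMap.proj (R := ℝ) (φ := fun _ : ι => ℝ) i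
  let Φ : (κ → ℝ) →ₗ[ℝ] (μ → ℝ) :=
    LinearMap.pi fun m : μ => match m with
      | Sum.inl ⟨σ, j, a⟩ =>
          pκ (Sum.inl (σ, j.succ, a)) - pκ (Sum.inl (σ, 0, a)) -
            ∑ m', ((Z₀.cell σ).frame a m' : ℝ) • pκ (Sum.inr (Sum.inr (σ, m', j)))
      | Sum.inr ⟨σ, i, j, a⟩ =>
          pκ (Sum.inl (σ, i.succAbove (Z₀.facetPerm σ i j), a)) -
            pκ (Sum.inr (Sum.inl (Z₀.facetClass σ i, j, a)))
  let Ψ : (ι → ℝ) →ₗ[ℝ] (μ → ℝ) :=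
    LinearMap.pi fun m : μ => match m with
      | Sum.inl _ => 0
      | Sum.inr ⟨σ, i, _, a⟩ => ∑ b, (Z₀.facetShift σ i b : ℝ) • pι (a, b)
  have Φ_inl : ∀ (u : κ → ℝ) σ j a, Φ u (Sum.inl (σ, j, a)) =
      u (Sum.inl (σ, j.succ, a)) - u (Sum.inl (σ, 0, a)) -
        ∑ m', ((Z₀.cell σ).frame a m' : ℝ) * u (Sum.inr (Sum.inr (σ, m', j))) := by
    intro u σ j a
    simp [Φ, pκ, LinearMap.pi_apply, Finset.sum_apply]
  have Φ_inr : ∀ (u : κ → ℝ) σ i j a, Φ u (Sum.inr (σ, i, j, a)) =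
      u (Sum.inl (σ, i.succAbove (Z₀.facetPerm σ i j), a)) -
        u (Sum.inr (Sum.inl (Z₀.facetClass σ i, j, a))) := by
    intro u σ i j a
    simp [Φ, pκ, LinearMap.pi_apply]
  have Ψ_inl : ∀ (t : ι → ℝ) x, Ψ t (Sum.inl x) = 0 := by
    intro t x
    simp [Ψ, LinearMap.pi_apply]
  have Ψ_inr : ∀ (t : ι → ℝ) σ i j a, Ψ t (Sum.inr (σ, i, j, a)) =
      ∑ b, (Z₀.facetShift σ i b : ℝ) * t (a, b) := by
    intro t σ i j a
    simp [Ψ, pι, LinearMap.pi_apply, Finset.sum_apply]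
  let u₀ : κ → ℝ := fun k => match k with
    | Sum.inl ⟨σ, j, a⟩ => (Z₀.cell σ).vertex j a
    | Sum.inr (Sum.inl ⟨f, j, a⟩) => Z₀.refFacet f j a
    | Sum.inr (Sum.inr ⟨σ, m, j⟩) => (Z₀.cell σ).edgeCoeff m j
  have hiff : ∀ (u : κ → ℝ) (t : ι → ℝ), Φ u = Ψ t ↔
      ((∀ (σ : Fin Z₀.numCells) (j : Fin n) (a : Fin (2 * n)),
          u (Sum.inl (σ, j.succ, a)) - u (Sum.inl (σ, 0, a)) =
            ∑ m, ((Z₀.cell σ).frame a m : ℝ) * u (Sum.inr (Sum.inr (σ, m, j)))) ∧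
       (∀ (σ : Fin Z₀.numCells) (i : Fin (n + 1)) (j : Fin n) (a : Fin (2 * n)),
          u (Sum.inl (σ, i.succAbove (Z₀.facetPerm σ i j), a)) =
            u (Sum.inr (Sum.inl (Z₀.facetClass σ i, j, a))) + ∑ b, t (a, b) * (Z₀.facetShift σ i b : ℝ))) := by
    intro u t
    constructor
    · intro h
      constructor
      · intro σ j a
        have e := congrFun h (Sum.inl (σ, j, a))
        rw [Φ_inl, Ψ_inl] at e
        linarith
      · intro σ i j a
        have e := congrFun h (Sum.inr (σ, i, j, a))
        rw [Φ_inr, Ψ_inr, sub_eq_iff_eq_add'] at e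
        rw [e]
        congr 1
        exact Finset.sum_congr rfl fun b _ => mul_comm _ _
    · rintro ⟨h1, h2⟩
      funext m
      rcases m with ⟨σ, j, a⟩ | ⟨σ, i, j, a⟩
      · rw [Φ_inl, Ψ_inl, h1 σ j a, sub_self]
      · rw [Φ_inr, Ψ_inr, h2 σ i j a, add_sub_cancel_left]
        exact Finset.sum_congr rfl fun b _ => mul_comm _ _
  refine ⟨Φ, Ψ, u₀, hiff, fun σ j a => rfl, fun σ m j => rfl, ?_⟩
  rw [hiff]
  exact ⟨fun σ j a => (Z₀.cell σ).vertex_succ_sub j a, fun σ i j a => Z₀.facet_eq σ i j a⟩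

/-! ### The dichotomy at a seed: obstructed, or linearly realisable over the whole period domain -/

/-- **Dichotomy.** For an effective tropical `n`-cycle `Z₀` (over any period), EITHER some linear
functional on `2n × 2n` matrices is non-zero on a symmetric `J`-commuting matrix and vanishes at every
symmetric `J`-commuting period over which the combinatorial type of `Z₀` realises (OBSTRUCTED), OR the
linearised realisation system is solvable in every direction `D ∈ Sym_J` (LINEARLY REALISABLE: data
`(v, T, r)` with the edge equations of the type and facet identifications with period `D`).
[cite: Zharkov2020TropicalWeil, §1–2 (pp. 2–4)] -/
theorem obstructed_or_linearSection {n : ℕ} {Q₀ : Matrix (Fin (2 * n)) (Fin (2 * n)) ℝ}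
    (Z₀ : TropicalTorusCycle (2 * n) n Q₀) :
    (∃ ℓ : Matrix (Fin (2 * n)) (Fin (2 * n)) ℝ →ₗ[ℝ] ℝ,
      (∃ D : Matrix (Fin (2 * n)) (Fin (2 * n)) ℝ, D.IsSymm ∧ D * weilJ n = weilJ n * D ∧ ℓ D ≠ 0) ∧
      ∀ Q' : Matrix (Fin (2 * n)) (Fin (2 * n)) ℝ, Q'.IsSymm → Q' * weilJ n = weilJ n * Q' →
        (∃ Z' : TropicalTorusCycle (2 * n) n Q',
          ∃ (hc : Z'.numCells = Z₀.numCells) (hf : Z'.numFacetClasses = Z₀.numFacetClasses),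
            ∀ σ : Fin Z'.numCells,
              (Z'.cell σ).weight = (Z₀.cell (Fin.cast hc σ)).weight ∧
              (Z'.cell σ).frame = (Z₀.cell (Fin.cast hc σ)).frame ∧
              ∀ i : Fin (n + 1),
                Fin.cast hf (Z'.facetClass σ i) = Z₀.facetClass (Fin.cast hc σ) i ∧
                Z'.facetPerm σ i = Z₀.facetPerm (Fin.cast hc σ) i ∧
                Z'.facetShift σ i = Z₀.facetShift (Fin.cast hc σ) i) → ℓ Q' = 0) ∨
    (∀ D : Matrix (Fin (2 * n)) (Fin (2 * n)) ℝ, D.IsSymm → D * weilJ n = weilJ n * D →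
      ∃ (v : Fin Z₀.numCells → Fin (n + 1) → Fin (2 * n) → ℝ)
        (T : Fin Z₀.numCells → Matrix (Fin n) (Fin n) ℝ)
        (r : Fin Z₀.numFacetClasses → Fin n → Fin (2 * n) → ℝ),
        (∀ (σ : Fin Z₀.numCells) (j : Fin n) (a : Fin (2 * n)),
            v σ j.succ a - v σ 0 a = ∑ m, ((Z₀.cell σ).frame a m : ℝ) * T σ m j) ∧
        (∀ (σ : Fin Z₀.numCells) (i : Fin (n + 1)) (j : Fin n) (a : Fin (2 * n)),
            v σ (i.succAbove (Z₀.facetPerm σ i j)) a =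
              r (Z₀.facetClass σ i) j a + ∑ b, D a b * (Z₀.facetShift σ i b : ℝ))) := by
  classical
  obtain ⟨Φ, Ψ, u₀, hiff, -, -, -⟩ := realisationSystem Z₀
  by_cases h : ∀ D : Matrix (Fin (2 * n)) (Fin (2 * n)) ℝ, D.IsSymm → D * weilJ n = weilJ n * D →
      Ψ (fun ab => D ab.1 ab.2) ∈ LinearMap.range Φ
  · -- linearly realisable
    refine Or.inr fun D hS hJ => ?_
    obtain ⟨u, hu⟩ := h D hS hJ
    obtain ⟨h1, h2⟩ := (hiff u _).1 hu
    exact ⟨fun σ j a => u (Sum.inl (σ, j, a)), fun σ => Matrix.of fun m j => u (Sum.inr (Sum.inr (σ, m, j))),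
      fun f j a => u (Sum.inr (Sum.inl (f, j, a))), fun σ j a => by simpa using h1 σ j a, h2⟩
  · -- obstructed: a functional vanishing on `range Φ` and not at `Ψ(D₀)`
    push Not at h
    obtain ⟨D₀, hD₀S, hD₀J, hD₀⟩ := h
    obtain ⟨φ, hφD, hφ0⟩ := Submodule.exists_dual_map_eq_bot_of_notMem hD₀ inferInstance
    -- the entries map `Q' ↦ (ab ↦ Q' ab.1 ab.2)` as a linear map
    let ent : Matrix (Fin (2 * n)) (Fin (2 * n)) ℝ →ₗ[ℝ] (Fin (2 * n) × Fin (2 * n) → ℝ) :=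
      LinearMap.pi fun ab => (LinearMap.proj (R := ℝ) (φ := fun _ : Fin (2 * n) => ℝ) ab.2).comp
        (LinearMap.proj (R := ℝ) (φ := fun _ : Fin (2 * n) => Fin (2 * n) → ℝ) ab.1)
    have hent : ∀ Q' : Matrix (Fin (2 * n)) (Fin (2 * n)) ℝ, ent Q' = fun ab => Q' ab.1 ab.2 := by
      intro Q'; funext ab; rfl
    refine Or.inl ⟨φ ∘ₗ Ψ ∘ₗ ent, ⟨D₀, hD₀S, hD₀J, by
      rw [LinearMap.comp_apply, LinearMap.comp_apply, hent]; exact hφD⟩, ?_⟩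
    rintro Q' - - ⟨Z', hc, hf, hsame⟩
    -- the data of `Z'`, re-indexed along `hc`, `hf`, solve the system at `Q'`
    have hmem : Ψ (fun ab => Q' ab.1 ab.2) ∈ LinearMap.range Φ := by
      refine ⟨fun k => match k with
        | Sum.inl ⟨σ, j, a⟩ => (Z'.cell (Fin.cast hc.symm σ)).vertex j a
        | Sum.inr (Sum.inl ⟨f, j, a⟩) => Z'.refFacet (Fin.cast hf.symm f) j a
        | Sum.inr (Sum.inr ⟨σ, m, j⟩) => (Z'.cell (Fin.cast hc.symm σ)).edgeCoeff m j, ?_⟩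
      rw [hiff]
      constructor
      · intro σ j a
        have hσ : Fin.cast hc (Fin.cast hc.symm σ) = σ := Fin.ext rfl
        obtain ⟨-, hfr, -⟩ := hsame (Fin.cast hc.symm σ)
        rw [hσ] at hfr
        have e := (Z'.cell (Fin.cast hc.symm σ)).vertex_succ_sub j a
        rw [hfr] at e
        exact e
      · intro σ i j a
        have hσ : Fin.cast hc (Fin.cast hc.symm σ) = σ := Fin.ext rfl
        obtain ⟨-, -, hrest⟩ := hsame (Fin.cast hc.symm σ)
        obtain ⟨hcl, hpm, hsh⟩ := hrest i
        rw [hσ] at hcl hpm hsh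
        have hcl' : Z'.facetClass (Fin.cast hc.symm σ) i = Fin.cast hf.symm (Z₀.facetClass σ i) := by
          rw [← hcl]; exact Fin.ext rfl
        have e := Z'.facet_eq (Fin.cast hc.symm σ) i j a
        rw [hpm, hsh, hcl'] at e
        exact e
    have : (φ ∘ₗ Ψ ∘ₗ ent) Q' ∈ (LinearMap.range Φ).map φ := by
      rw [LinearMap.comp_apply, LinearMap.comp_apply, hent]
      exact Submodule.mem_map_of_mem hmem
    rw [hφ0] at this
    simpa using this

/-! ### Linear realisability spreads the type over the whole period domain -/

/-- **Linear spread.** If the combinatorial type of `Z₀` (over a symmetric `J`-commuting `Q₀`) is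
linearly realisable in every direction of `Sym_J`, then there are families of real data `V(P)`, `T(P)`
(continuous, `T(Q₀) =` the edge matrices of `Z₀`), `Rf(P)` satisfying the edge equations and facet
identifications of the type over EVERY symmetric `J`-commuting `P` (a right inverse of `Φ` on its range,
extended linearly). [cite: Zharkov2020TropicalWeil, §2 (p. 3)] -/
theorem linearSpread {n : ℕ} {Q₀ : Matrix (Fin (2 * n)) (Fin (2 * n)) ℝ} (hQ₀S : Q₀.IsSymm)
    (hQ₀J : Q₀ * weilJ n = weilJ n * Q₀) (Z₀ : TropicalTorusCycle (2 * n) n Q₀)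
    (hsec : ∀ D : Matrix (Fin (2 * n)) (Fin (2 * n)) ℝ, D.IsSymm → D * weilJ n = weilJ n * D →
      ∃ (v : Fin Z₀.numCells → Fin (n + 1) → Fin (2 * n) → ℝ)
        (T : Fin Z₀.numCells → Matrix (Fin n) (Fin n) ℝ)
        (r : Fin Z₀.numFacetClasses → Fin n → Fin (2 * n) → ℝ),
        (∀ (σ : Fin Z₀.numCells) (j : Fin n) (a : Fin (2 * n)),
            v σ j.succ a - v σ 0 a = ∑ m, ((Z₀.cell σ).frame a m : ℝ) * T σ m j) ∧
        (∀ (σ : Fin Z₀.numCells) (i : Fin (n + 1)) (j : Fin n) (a : Fin (2 * n)),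
            v σ (i.succAbove (Z₀.facetPerm σ i j)) a =
              r (Z₀.facetClass σ i) j a + ∑ b, D a b * (Z₀.facetShift σ i b : ℝ))) :
    ∃ (V : Matrix (Fin (2 * n)) (Fin (2 * n)) ℝ → Fin Z₀.numCells → Fin (n + 1) → Fin (2 * n) → ℝ)
      (T : Matrix (Fin (2 * n)) (Fin (2 * n)) ℝ → Fin Z₀.numCells → Matrix (Fin n) (Fin n) ℝ)
      (Rf : Matrix (Fin (2 * n)) (Fin (2 * n)) ℝ → Fin Z₀.numFacetClasses → Fin n → Fin (2 * n) → ℝ),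
      (∀ σ, Continuous fun P => T P σ) ∧
      (∀ σ, T Q₀ σ = (Z₀.cell σ).edgeCoeff) ∧
      ∀ P : Matrix (Fin (2 * n)) (Fin (2 * n)) ℝ, P.IsSymm → P * weilJ n = weilJ n * P →
        (∀ (σ : Fin Z₀.numCells) (j : Fin n) (a : Fin (2 * n)),
            V P σ j.succ a - V P σ 0 a = ∑ m, ((Z₀.cell σ).frame a m : ℝ) * T P σ m j) ∧
        (∀ (σ : Fin Z₀.numCells) (i : Fin (n + 1)) (j : Fin n) (a : Fin (2 * n)),
            V P σ (i.succAbove (Z₀.facetPerm σ i j)) a =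
              Rf P (Z₀.facetClass σ i) j a + ∑ b, P a b * (Z₀.facetShift σ i b : ℝ)) := by
  classical
  obtain ⟨Φ, Ψ, u₀, hiff, -, hu₀T, hu₀⟩ := realisationSystem Z₀
  -- `Ψ(Sym_J) ⊆ range Φ`
  have hrange : ∀ D : Matrix (Fin (2 * n)) (Fin (2 * n)) ℝ, D.IsSymm → D * weilJ n = weilJ n * D →
      Ψ (fun ab => D ab.1 ab.2) ∈ LinearMap.range Φ := by
    intro D hS hJ
    obtain ⟨v, T, r, h1, h2⟩ := hsec D hS hJ
    refine ⟨fun k => match k with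
      | Sum.inl ⟨σ, j, a⟩ => v σ j a
      | Sum.inr (Sum.inl ⟨f, j, a⟩) => r f j a
      | Sum.inr (Sum.inr ⟨σ, m, j⟩) => T σ m j, ?_⟩
    rw [hiff]
    exact ⟨h1, h2⟩
  -- a linear right inverse of `Φ` on its range, extended to the whole space
  obtain ⟨g, hg⟩ := Φ.rangeRestrict.exists_rightInverse_of_surjective Φ.range_rangeRestrict
  obtain ⟨G, hG⟩ := LinearMap.exists_extend g
  have hΦG : ∀ y ∈ LinearMap.range Φ, Φ (G y) = y := by
    intro y hy
    have h1 : G y = g ⟨y, hy⟩ := by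
      have := LinearMap.congr_fun hG ⟨y, hy⟩
      simpa using this
    have h2 := LinearMap.congr_fun hg ⟨y, hy⟩
    have h3 := congrArg Subtype.val h2
    rw [h1]
    exact h3
  -- the affine family through `u₀`
  let tP : Matrix (Fin (2 * n)) (Fin (2 * n)) ℝ → (Fin (2 * n) × Fin (2 * n) → ℝ) := fun P ab => P ab.1 ab.2
  let uP : Matrix (Fin (2 * n)) (Fin (2 * n)) ℝ →
      ((Fin Z₀.numCells × Fin (n + 1) × Fin (2 * n)) ⊕
        ((Fin Z₀.numFacetClasses × Fin n × Fin (2 * n)) ⊕ (Fin Z₀.numCells × Fin n × Fin n)) → ℝ) :=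
    fun P => u₀ + G (Ψ (tP (P - Q₀)))
  refine ⟨fun P σ j a => uP P (Sum.inl (σ, j, a)),
    fun P σ => Matrix.of fun m j => uP P (Sum.inr (Sum.inr (σ, m, j))),
    fun P f j a => uP P (Sum.inr (Sum.inl (f, j, a))), ?_, ?_, ?_⟩
  · intro σ
    have h1 : Continuous tP :=
      continuous_pi fun ab => (continuous_apply ab.2).comp (continuous_apply ab.1)
    have hcont : Continuous uP :=
      continuous_const.add (G.continuous_of_finiteDimensional.comp
        (Ψ.continuous_of_finiteDimensional.comp (h1.comp (continuous_id.sub continuous_const))))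
    exact continuous_matrix fun m j =>
      (continuous_apply (Sum.inr (Sum.inr (σ, m, j)))).comp hcont
  · intro σ
    ext m j
    have h0 : tP (Q₀ - Q₀) = 0 := by funext ab; simp [tP]
    simp only [Matrix.of_apply, uP, h0, map_zero, add_zero]
    exact hu₀T σ m j
  · intro P hPS hPJ
    have hD : Ψ (tP (P - Q₀)) ∈ LinearMap.range Φ :=
      hrange (P - Q₀) (hPS.sub hQ₀S) (by rw [Matrix.sub_mul, Matrix.mul_sub, hPJ, hQ₀J])
    have hsol : Φ (uP P) = Ψ (tP P) := by
      show Φ (u₀ + G (Ψ (tP (P - Q₀)))) = Ψ (tP P)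
      rw [map_add, hΦG _ hD, hu₀, ← map_add]
      congr 1
      funext ab
      simp [tP]
    obtain ⟨h1, h2⟩ := (hiff _ _).1 hsol
    exact ⟨fun σ j a => by simpa using h1 σ j a, h2⟩

end Summit.HodgeConjecture.HodgeConjecture.Theorems.TropicalWeilVanishing

end
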